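import Mathlib

/-!
# The a-posteriori inverse bound of the D2 ball recursion in any normed ring, and the congruence bound in the spectral norm (cap g4, cell `ns-blowup`, 2026-08-26)

HONEST FRAMING (human ruling D-0035): nothing here is a claim about Navier–Stokes blow-up.
WHAT THIS IS NOT: not NS evidence. Two norm facts used at every level of the MONOTONE
a-posteriori skew-cut recursion of `cap/d2/d2_cert.py` (PREREG «D2-3L-X0» STATUS l.1438; chain map
`cap/D2-CHAIN-MAP.md` step S4 (a)–(b)), stated in the generality the script uses them (complex
Hermitian blocks, SPECTRAL norm), complementing the real `ℓ^∞`-operator-norm form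
`SkewCutAPosteriori.norm_inv_le_of_norm_one_sub_mul_lt` (p406415):

* `Units.norm_inv_sub_le` — in ANY normed ring: if `a` is invertible and the float inverse `r`
  satisfies `θ := ‖1 − r·a‖ < 1`, then `‖a⁻¹ − r‖ ≤ ‖r‖·θ/(1 − θ)` (the script's
  `delta = ||X~|| theta/(1-theta) ≥ ||L^{-1} − X~||`; no completeness / Neumann series needed because
  invertibility of `a = L_{u−1}` is known independently — it is certified positive definite).
  Also `Units.norm_inv_le`: `‖a⁻¹‖ ≤ ‖r‖/(1 − θ)`.
* `Matrix.l2_opNorm_conjTranspose_mul_mul_le` — `‖Cᴴ E C‖ ≤ ‖C‖²·‖E‖` for rectangular `C` in the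
  `L²`-operator (spectral) norm (`Matrix.Norms.L2Operator`), the bound behind the script's
  `||C||^2 delta` shift; and `Matrix.l2_opNorm_hermPart_le`: `‖(M + Mᴴ)/2‖ ≤ ‖M‖`.

Mathlib only; no new definitions.
-/

namespace Summit.NavierStokesRegularity.FluidComputer.APosterioriInverseBound

section NormedRing

variable {A : Type*} [NormedRing A]

/-- **A-posteriori bound on the inverse (any normed ring).** For a unit `a` and any `r` with
`‖1 − r·a‖ < 1`: `‖a⁻¹‖ ≤ ‖r‖/(1 − ‖1 − r·a‖)` — from `a⁻¹ = (1 − r a)a⁻¹ + r`. -/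
theorem Units.norm_inv_le (a : Aˣ) (r : A) (hθ : ‖1 - r * a‖ < 1) :
    ‖(↑a⁻¹ : A)‖ ≤ ‖r‖ / (1 - ‖1 - r * a‖) := by
  set θ := ‖1 - r * (a : A)‖ with hθdef
  have key : (↑a⁻¹ : A) - r = (1 - r * a) * ↑a⁻¹ := by
    rw [sub_mul, one_mul, mul_assoc, Units.mul_inv, mul_one]
  have h1 : ‖(↑a⁻¹ : A) - r‖ ≤ θ * ‖(↑a⁻¹ : A)‖ := by
    rw [key]; exact norm_mul_le _ _
  have h2 : ‖(↑a⁻¹ : A)‖ ≤ ‖(↑a⁻¹ : A) - r‖ + ‖r‖ := by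
    have := norm_add_le ((↑a⁻¹ : A) - r) r
    simpa using this
  have h1θ : 0 < 1 - θ := by linarith
  rw [le_div_iff₀ h1θ]
  nlinarith [norm_nonneg ((↑a⁻¹ : A) - r), norm_nonneg r]

/-- **A-posteriori bound on the inverse ERROR (any normed ring).** For a unit `a` and any `r`
with `θ := ‖1 − r·a‖ < 1`: `‖a⁻¹ − r‖ ≤ ‖r‖·θ/(1 − θ)`. This is `delta` of the D2 recursion
(`r = X~` the float inverse of the certified block `a = L_{u−1}`, spectral norm). -/
theorem Units.norm_inv_sub_le (a : Aˣ) (r : A) (hθ : ‖1 - r * a‖ < 1) :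
    ‖(↑a⁻¹ : A) - r‖ ≤ ‖r‖ * ‖1 - r * a‖ / (1 - ‖1 - r * a‖) := by
  set θ := ‖1 - r * (a : A)‖ with hθdef
  have key : (↑a⁻¹ : A) - r = (1 - r * a) * ↑a⁻¹ := by
    rw [sub_mul, one_mul, mul_assoc, Units.mul_inv, mul_one]
  have h1 : ‖(↑a⁻¹ : A) - r‖ ≤ θ * ‖(↑a⁻¹ : A)‖ := by
    rw [key]; exact norm_mul_le _ _
  have h2 := Units.norm_inv_le a r hθ
  have hθ0 : 0 ≤ θ := norm_nonneg _
  have h1θ : 0 < 1 - θ := by linarith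
  calc ‖(↑a⁻¹ : A) - r‖ ≤ θ * ‖(↑a⁻¹ : A)‖ := h1
    _ ≤ θ * (‖r‖ / (1 - θ)) := mul_le_mul_of_nonneg_left h2 hθ0
    _ = ‖r‖ * θ / (1 - θ) := by ring

end NormedRing

section Spectral

open scoped Matrix.Norms.L2Operator
open Matrix

variable {m n : Type*} [Fintype m] [DecidableEq m] [Fintype n] [DecidableEq n]

/-- **Congruence bound in the spectral norm:** `‖Cᴴ E C‖ ≤ ‖C‖²‖E‖` for `C : m × n`, `E : m × m`
over `ℂ` (`‖Cᴴ‖ = ‖C‖` and submultiplicativity of the `L²`-operator norm). With `E = L⁻¹ − X~`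
and `‖E‖ ≤ δ` this is the `||C||^2 delta` shift of the D2 recursion's `S_u`. -/
theorem Matrix.l2_opNorm_conjTranspose_mul_mul_le (C : Matrix m n ℂ) (E : Matrix m m ℂ) :
    ‖Cᴴ * E * C‖ ≤ ‖C‖ ^ 2 * ‖E‖ := by
  calc ‖Cᴴ * E * C‖ ≤ ‖Cᴴ * E‖ * ‖C‖ := l2_opNorm_mul _ _
    _ ≤ ‖Cᴴ‖ * ‖E‖ * ‖C‖ := by gcongr; exact l2_opNorm_mul _ _
    _ = ‖C‖ ^ 2 * ‖E‖ := by rw [l2_opNorm_conjTranspose]; ring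

/-- **The Hermitian part does not increase the spectral norm:** `‖(M + Mᴴ)/2‖ ≤ ‖M‖`
(the recursion subtracts `Herm(Cᴴ X~ C)`; together with the previous lemma,
`‖Herm(Cᴴ E C)‖ ≤ ‖C‖²‖E‖`). -/
theorem Matrix.l2_opNorm_hermPart_le (M : Matrix n n ℂ) :
    ‖(2:ℂ)⁻¹ • (M + Mᴴ)‖ ≤ ‖M‖ := by
  have h1 : ‖M + Mᴴ‖ ≤ ‖M‖ + ‖M‖ := by
    calc ‖M + Mᴴ‖ ≤ ‖M‖ + ‖Mᴴ‖ := norm_add_le _ _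
      _ = ‖M‖ + ‖M‖ := by rw [l2_opNorm_conjTranspose]
  calc ‖(2:ℂ)⁻¹ • (M + Mᴴ)‖ ≤ ‖(2:ℂ)⁻¹‖ * ‖M + Mᴴ‖ := norm_smul_le _ _
    _ = 2⁻¹ * ‖M + Mᴴ‖ := by simp
    _ ≤ ‖M‖ := by linarith

end Spectral

end Summit.NavierStokesRegularity.FluidComputer.APosterioriInverseBound
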